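import Mathlib
import HarnessLib
import Literature.Analysis.FluidPDE.SuitableWeak
import Summits.NavierStokesRegularity.NavierStokesRegularity.Theorems.TypeIQuarterGateSliceBudgetDefs
import Summits.NavierStokesRegularity.NavierStokesRegularity.Theorems.TypeIQuarterGateScarEnvelopeTypeISliceBudgetNullTable

/-!
# Line `slice_budget` on crux `TypeIQuarterGate.ScarEnvelopeTypeI` (stmt-NavierStokesRegularity-23843) —
# THE NULL TABLE, part 2/2: THE DIAGONAL THEOREM (S5) and THE NEAR CEILING (S1)

Second half of the instrument seat's helper (author: nsreg-p3 g24, cell `pub/ns-regularity-ideate`, memo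
`ns-regularity-ideate-p3/round-28/ROUND-28.md`; tree-ready file `round-28/TypeIQuarterGateScarEnvelopeTypeISliceBudgetNullTable.lean`
sha16 ae5a6735b18f6355, attached as evidence #14 on stmt-23843; its Lean plates `Null28.lean` c95cef85bcbfdce0 and
`Diagonal28.lean` bd8264fe8f43b25a).  LANDED VERBATIM by a prover hand (ns-in-wu-con g2, DIRECTOR-NS #204 (3) /
inputs-15: the author seat cannot write `Theorems/`, `perm.theorems-prover-only`), split in two files only to respect
the 400-line rule: part 1 = `…SliceBudgetNullTable.lean` ((L1)–(L4), `octaveCube`, the scar clause, the outer end);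
this part = (S5) `sd_fails_only_on_the_diagonal` (+ `_tendsto`, `_of_typeI`) and (S1) `rate_of_isTypeIBlowup`,
`slice_energy_le_of_cknA`, `nearCeiling_of_rate_of_slice`.  Every declaration text is byte-identical with the
author's file; see part 1 for the full description.

NOTHING here narrows the crux or proves SD (`SliceBudget.stub_sliceOctaveBudget`); no statement about the crux, its
route `TypeIQuarterGate` or the summit is proved here.  hard core evaded: none.
-/

noncomputable section

-- the summit-side namespace repeats a component by design (single-conjunct summit, D-0017).
set_option linter.dupNamespace false

namespace Summit.NavierStokesRegularity.NavierStokesRegularity.Cruxes.ScarEnvelopeTypeI.SliceBudget.NullTable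

open MeasureTheory Set Metric Filter Topology
open scoped ENNReal NNReal
open Literature.Analysis.FluidPDE

/-! ## The diagonal theorem -/

/-- **SD fails only on the diagonal.**  If the slice-octave budget `OctaveBudget ν T u` FAILS for a field with
finitely many scars (the clause for `σ`) obeying the near ceiling, then at some singular point `a` there are times
`t_k ∈ (T − 1/(k+1), T)` and scales `ℓ_k ∈ (0, 1/(k+1))` with `ℓ_k > k·√(T − t_k)` and `m(ℓ_k,t_k) > k`:
both ends of the octave range are closed, failure lives on `ℓ → 0`, `ℓ/√(T−t) → ∞`. -/
theorem sd_fails_only_on_the_diagonal {ν T : ℝ} (hν : 0 < ν) (hT : 0 < T) {u : ℝ → (EuclideanSpace ℝ (Fin 3)) → (EuclideanSpace ℝ (Fin 3))}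
    {σ : Finset (EuclideanSpace ℝ (Fin 3))}
    (hσ : ∀ x ∉ σ, ∃ r : ℝ, 0 < r ∧ ∃ A : ℝ,
      ∀ t ∈ Set.Ico (T - r ^ 2) T, ∀ y ∈ Metric.ball x r, ‖u t y‖ ≤ A)
    (hnear : ∀ a : (EuclideanSpace ℝ (Fin 3)), SingularPt T u a → ∃ K δ₁ r₁ : ℝ, 0 < δ₁ ∧ 0 < r₁ ∧
      ∀ t ∈ Set.Ioo (T - δ₁) T, ∀ ℓ : ℝ, Real.sqrt (ν * (T - t)) ≤ ℓ → ℓ ≤ r₁ →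
        octaveCube u a ℓ t ≤ ENNReal.ofReal (K * ℓ / Real.sqrt (T - t)))
    (hSD : ¬ OctaveBudget ν T u) :
    ∃ a : (EuclideanSpace ℝ (Fin 3)), SingularPt T u a ∧ a ∈ σ ∧ ∃ t ℓ : ℕ → ℝ, ∀ k : ℕ,
      T - 1 / ((k : ℝ) + 1) < t k ∧ t k < T ∧ 0 < ℓ k ∧ ℓ k < 1 / ((k : ℝ) + 1) ∧
      (k : ℝ) * Real.sqrt (T - t k) < ℓ k ∧
      ENNReal.ofReal (k : ℝ) < octaveCube u a (ℓ k) (t k) := by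
  classical
  -- unfold the failure of SD
  have h1 : ∃ a : (EuclideanSpace ℝ (Fin 3)), SingularPt T u a ∧ ∀ q δ r₀ : ℝ, 0 < δ → 0 < r₀ →
      ∃ t ∈ Set.Ioo (T - δ) T, ∃ ℓ : ℝ, Real.sqrt (ν * (T - t)) ≤ ℓ ∧ ℓ ≤ r₀ ∧
        ENNReal.ofReal q < octaveCube u a ℓ t := by
    by_contra hcon
    push Not at hcon
    apply hSD
    intro a ha
    obtain ⟨q, δ, r₀, hδ, hr₀, h⟩ := hcon a ha
    exact ⟨q, δ, r₀, hδ, hr₀, fun t ht ℓ hl1 hl2 => h t ht ℓ hl1 hl2⟩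
  obtain ⟨a, ha, hfail⟩ := h1
  have haσ : a ∈ σ := singularPt_mem_scars hT hσ ha
  obtain ⟨ρ₀, hρ₀, hiso⟩ := exists_isolating_radius σ a
  obtain ⟨K, δ₁, r₁, hδ₁, hr₁, hK⟩ := hnear a ha
  -- positive version of K
  set Kp : ℝ := max K 1 with hKp
  have hKp1 : 1 ≤ Kp := le_max_right _ _
  have hKpos : 0 < Kp := by linarith
  -- one step of the extraction, for each k
  have step : ∀ k : ℕ, ∃ t ℓ : ℝ, T - 1 / ((k : ℝ) + 1) < t ∧ t < T ∧ 0 < ℓ ∧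
      ℓ < 1 / ((k : ℝ) + 1) ∧ (k : ℝ) * Real.sqrt (T - t) < ℓ ∧
      ENNReal.ofReal (k : ℝ) < octaveCube u a ℓ t := by
    intro k
    have hk1 : (0 : ℝ) < (k : ℝ) + 1 := by positivity
    have hls : (0 : ℝ) < 1 / ((k : ℝ) + 2) := by positivity
    obtain ⟨M, δ₂, hδ₂, hM⟩ := outer_bound hσ a hiso hls
    -- the parameters fed to the failure of SD
    set q : ℝ := max (max (k : ℝ) M) (Kp * ((k : ℝ) + 1)) with hq
    set δ : ℝ := min (min δ₁ δ₂) (1 / ((k : ℝ) + 1)) with hδ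
    set r₀ : ℝ := min ρ₀ r₁ with hr₀
    have hδpos : 0 < δ := lt_min (lt_min hδ₁ hδ₂) (by positivity)
    have hr₀pos : 0 < r₀ := lt_min hρ₀ hr₁
    obtain ⟨t, ht, ℓ, hℓ1, hℓ2, hcube⟩ := hfail q δ r₀ hδpos hr₀pos
    have hδ_1 : δ ≤ δ₁ := (min_le_left _ _).trans (min_le_left _ _)
    have hδ_2 : δ ≤ δ₂ := (min_le_left _ _).trans (min_le_right _ _)
    have hδ_3 : δ ≤ 1 / ((k : ℝ) + 1) := min_le_right _ _
    have htT : t < T := ht.2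
    have ht1 : t ∈ Set.Ioo (T - δ₁) T := ⟨by linarith [ht.1], htT⟩
    have ht2 : t ∈ Set.Ioo (T - δ₂) T := ⟨by linarith [ht.1], htT⟩
    have hsqrtν_pos : 0 < Real.sqrt (ν * (T - t)) :=
      Real.sqrt_pos.2 (mul_pos hν (by linarith))
    have hsqrt_pos : 0 < Real.sqrt (T - t) := Real.sqrt_pos.2 (by linarith)
    have hℓpos : 0 < ℓ := lt_of_lt_of_le hsqrtν_pos hℓ1
    have hq_k : (k : ℝ) ≤ q := (le_max_left _ _).trans (le_max_left _ _)
    have hq_M : M ≤ q := (le_max_right _ _).trans (le_max_left _ _)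
    have hq_K : Kp * ((k : ℝ) + 1) ≤ q := le_max_right _ _
    -- outer end: ℓ < 1/(k+2)
    have hℓsmall : ℓ < 1 / ((k : ℝ) + 2) := by
      by_contra hcon
      push Not at hcon
      have hb := hM t ht2 ℓ hcon (hℓ2.trans (min_le_left _ _))
      have : octaveCube u a ℓ t ≤ ENNReal.ofReal q :=
        hb.trans (ENNReal.ofReal_le_ofReal hq_M)
      exact (lt_irrefl _) (lt_of_lt_of_le hcube this)
    -- near end: ℓ / √(T-t) > k
    have hnearb := hK t ht1 ℓ hℓ1 (hℓ2.trans (min_le_right _ _))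
    have hnearb' : octaveCube u a ℓ t ≤ ENNReal.ofReal (Kp * ℓ / Real.sqrt (T - t)) := by
      refine hnearb.trans (ENNReal.ofReal_le_ofReal ?_)
      apply div_le_div_of_nonneg_right _ hsqrt_pos.le
      exact mul_le_mul_of_nonneg_right (le_max_left _ _) hℓpos.le
    have hlt : ENNReal.ofReal q < ENNReal.ofReal (Kp * ℓ / Real.sqrt (T - t)) :=
      lt_of_lt_of_le hcube hnearb'
    have hlt' : q < Kp * ℓ / Real.sqrt (T - t) := by
      have hpos : 0 < Kp * ℓ / Real.sqrt (T - t) := by positivity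
      exact (ENNReal.ofReal_lt_ofReal_iff hpos).1 hlt
    have hratio : (k : ℝ) * Real.sqrt (T - t) < ℓ := by
      have h2 : Kp * ((k : ℝ) + 1) < Kp * ℓ / Real.sqrt (T - t) := lt_of_le_of_lt hq_K hlt'
      have h3 : ((k : ℝ) + 1) * Real.sqrt (T - t) < ℓ := by
        have h4 : Kp * ((k : ℝ) + 1) * Real.sqrt (T - t) < Kp * ℓ := by
          have := (lt_div_iff₀ hsqrt_pos).1 h2
          linarith
        have h5 : Kp * (((k : ℝ) + 1) * Real.sqrt (T - t)) < Kp * ℓ := by linarith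
        exact lt_of_mul_lt_mul_left h5 hKpos.le
      have h6 : (k : ℝ) * Real.sqrt (T - t) ≤ ((k : ℝ) + 1) * Real.sqrt (T - t) := by
        apply mul_le_mul_of_nonneg_right _ hsqrt_pos.le; linarith
      exact lt_of_le_of_lt h6 h3
    refine ⟨t, ℓ, by linarith [ht.1], htT, hℓpos, ?_, hratio, ?_⟩
    · have : 1 / ((k : ℝ) + 2) < 1 / ((k : ℝ) + 1) := by
        apply one_div_lt_one_div_of_lt hk1; linarith
      exact hℓsmall.trans this
    · exact lt_of_le_of_lt (ENNReal.ofReal_le_ofReal hq_k) hcube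
  choose t ℓ hstep using step
  exact ⟨a, ha, haσ, t, ℓ, hstep⟩

/-- The limit form: `t_k → T`, `ℓ_k → 0⁺`, `ℓ_k/√(ν(T−t_k)) → ∞` (the octave index above the dissipative floor
diverges), `m(ℓ_k,t_k) → ∞` (eventually above every level). -/
theorem sd_fails_only_on_the_diagonal_tendsto {ν T : ℝ} (hν : 0 < ν) (hT : 0 < T) {u : ℝ → (EuclideanSpace ℝ (Fin 3)) → (EuclideanSpace ℝ (Fin 3))}
    {σ : Finset (EuclideanSpace ℝ (Fin 3))}
    (hσ : ∀ x ∉ σ, ∃ r : ℝ, 0 < r ∧ ∃ A : ℝ,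
      ∀ t ∈ Set.Ico (T - r ^ 2) T, ∀ y ∈ Metric.ball x r, ‖u t y‖ ≤ A)
    (hnear : ∀ a : (EuclideanSpace ℝ (Fin 3)), SingularPt T u a → ∃ K δ₁ r₁ : ℝ, 0 < δ₁ ∧ 0 < r₁ ∧
      ∀ t ∈ Set.Ioo (T - δ₁) T, ∀ ℓ : ℝ, Real.sqrt (ν * (T - t)) ≤ ℓ → ℓ ≤ r₁ →
        octaveCube u a ℓ t ≤ ENNReal.ofReal (K * ℓ / Real.sqrt (T - t)))
    (hSD : ¬ OctaveBudget ν T u) :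
    ∃ a : (EuclideanSpace ℝ (Fin 3)), SingularPt T u a ∧ a ∈ σ ∧ ∃ t ℓ : ℕ → ℝ, (∀ k, t k < T) ∧
      Tendsto t atTop (𝓝 T) ∧ Tendsto ℓ atTop (𝓝[>] 0) ∧
      Tendsto (fun k => ℓ k / Real.sqrt (ν * (T - t k))) atTop atTop ∧
      ∀ q : ℝ, ∀ᶠ k in atTop, ENNReal.ofReal q < octaveCube u a (ℓ k) (t k) := by
  obtain ⟨a, ha, haσ, t, ℓ, h⟩ := sd_fails_only_on_the_diagonal hν hT hσ hnear hSD
  refine ⟨a, ha, haσ, t, ℓ, fun k => (h k).2.1, ?_, ?_, ?_, ?_⟩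
  · -- t_k → T : squeezed between T - 1/(k+1) and T
    have hlow : Tendsto (fun k : ℕ => T - 1 / ((k : ℝ) + 1)) atTop (𝓝 T) := by
      have : Tendsto (fun k : ℕ => 1 / ((k : ℝ) + 1)) atTop (𝓝 0) :=
        tendsto_one_div_add_atTop_nhds_zero_nat
      simpa using (tendsto_const_nhds (x := T)).sub this
    refine tendsto_of_tendsto_of_tendsto_of_le_of_le hlow tendsto_const_nhds ?_ ?_
    · intro k; exact (h k).1.le
    · intro k; exact (h k).2.1.le
  · -- ℓ_k → 0 within (0, ∞)
    have hzero : Tendsto ℓ atTop (𝓝 0) := by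
      have hup : Tendsto (fun k : ℕ => 1 / ((k : ℝ) + 1)) atTop (𝓝 0) :=
        tendsto_one_div_add_atTop_nhds_zero_nat
      refine tendsto_of_tendsto_of_tendsto_of_le_of_le tendsto_const_nhds hup ?_ ?_
      · intro k; exact (h k).2.2.1.le
      · intro k; exact (h k).2.2.2.1.le
    refine tendsto_nhdsWithin_iff.2 ⟨hzero, Filter.Eventually.of_forall fun k => ?_⟩
    exact (h k).2.2.1
  · -- ratio → ∞ : ratio > k / √ν
    have hν' : 0 < Real.sqrt ν := Real.sqrt_pos.2 hν
    refine tendsto_atTop_mono (fun k => ?_) (tendsto_natCast_atTop_atTop.atTop_div_const hν')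
    have hk := (h k).2.2.2.2.1
    have htk : t k < T := (h k).2.1
    have hsqrt_pos : 0 < Real.sqrt (T - t k) := Real.sqrt_pos.2 (by linarith)
    have h1 : (k : ℝ) ≤ ℓ k / Real.sqrt (T - t k) := ((lt_div_iff₀ hsqrt_pos).2 hk).le
    have h2 : (k : ℝ) / Real.sqrt ν ≤ ℓ k / Real.sqrt (T - t k) / Real.sqrt ν :=
      div_le_div_of_nonneg_right h1 hν'.le
    rw [Real.sqrt_mul hν.le, mul_comm, ← div_div]
    exact h2
  · intro q
    refine (Filter.eventually_ge_atTop (Nat.ceil q)).mono fun k hk => ?_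
    have hq : q ≤ (k : ℝ) := (Nat.le_ceil q).trans (by exact_mod_cast hk)
    exact lt_of_le_of_lt (ENNReal.ofReal_le_ofReal hq) (h k).2.2.2.2.2

/-! ## The near end: the ceiling from the Type-I rate and the vertex slice-energy bound (memo S1) -/

/-- The explicit Type-I rate near `T` from the Literature predicate `IsTypeIBlowup u T`. -/
theorem rate_of_isTypeIBlowup {T : ℝ} {u : ℝ → (EuclideanSpace ℝ (Fin 3)) → (EuclideanSpace ℝ (Fin 3))} (h : IsTypeIBlowup u T) :
    ∃ C δ₀ : ℝ, 0 < δ₀ ∧ ∀ t ∈ Set.Ioo (T - δ₀) T, ∀ x : (EuclideanSpace ℝ (Fin 3)), ‖u t x‖ ≤ C / Real.sqrt (T - t) := by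
  obtain ⟨C, hC⟩ := h
  obtain ⟨l, hl, hsub⟩ := mem_nhdsLT_iff_exists_Ioo_subset.1 hC
  have hl' : l < T := hl
  refine ⟨C, T - l, by linarith, fun t ht x => ?_⟩
  have : t ∈ Set.Ioo l T := ⟨by linarith [ht.1], ht.2⟩
  exact hsub this x

/-- From the scaled slice-energy bound `cknA r (T,a) u ≤ K_A` (`0 < r`): the slice energy on `B_r(a)` at
every time of the backward cylinder is `≤ r·K_A`. -/
theorem slice_energy_le_of_cknA {T : ℝ} {u : ℝ → (EuclideanSpace ℝ (Fin 3)) → (EuclideanSpace ℝ (Fin 3))} {a : (EuclideanSpace ℝ (Fin 3))} {KA r : ℝ} (hr : 0 < r)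
    (hA : cknA r (T, a) u ≤ ENNReal.ofReal KA) {t : ℝ} (ht : t ∈ Set.Ioo (T - r ^ 2) T) :
    ∫⁻ y in Metric.ball a r, ‖u t y‖ₑ ^ 2 ≤ ENNReal.ofReal r * ENNReal.ofReal KA := by
  have h1 : (ENNReal.ofReal r)⁻¹ * ∫⁻ y in Metric.ball a r, ‖u t y‖ₑ ^ 2 ≤ cknA r (T, a) u := by
    unfold cknA
    exact le_iSup₂ (f := fun t (_ : t ∈ Set.Ioo ((T, a).1 - r ^ 2) (T, a).1) =>
      (ENNReal.ofReal r)⁻¹ * ∫⁻ y in Metric.ball (T, a).2 r, ‖u t y‖ₑ ^ 2) t ht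
  have hr0 : ENNReal.ofReal r ≠ 0 := by
    rw [ne_eq, ENNReal.ofReal_eq_zero, not_le]; exact hr
  have hrtop : ENNReal.ofReal r ≠ ⊤ := ENNReal.ofReal_ne_top
  calc ∫⁻ y in Metric.ball a r, ‖u t y‖ₑ ^ 2
      = ENNReal.ofReal r * ((ENNReal.ofReal r)⁻¹ * ∫⁻ y in Metric.ball a r, ‖u t y‖ₑ ^ 2) := by
        rw [← mul_assoc, ENNReal.mul_inv_cancel hr0 hrtop, one_mul]
    _ ≤ ENNReal.ofReal r * ENNReal.ofReal KA := by
        gcongr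
        exact h1.trans hA

/-- **S1 as a theorem: the near ceiling from the Type-I rate + the vertex slice bound.**  If
`‖u t x‖ ≤ C/√(T−t)` near `T` and, at every singular point `a`, `cknA r (T,a) u ≤ K_A` for `0 < r < r₂`,
then the near ceiling `m(ℓ,t) ≤ K ℓ/√(T−t)` holds for `√(ν(T−t)) ≤ ℓ ≤ r₁`, with
`K = max C 0 · (e + 1/√ν) · K_A`, `r₁ = r₂ / (2(e + 1/√ν))` (Hölder: sup × slice-L² on the ball of radius
`eℓ + √(T−t) ≤ (e + 1/√ν) ℓ`, whose backward cylinder contains the time `t`). -/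
theorem nearCeiling_of_rate_of_slice {ν T : ℝ} (hν : 0 < ν) {u : ℝ → (EuclideanSpace ℝ (Fin 3)) → (EuclideanSpace ℝ (Fin 3))}
    (hrate : ∃ C δ₀ : ℝ, 0 < δ₀ ∧ ∀ t ∈ Set.Ioo (T - δ₀) T, ∀ x : (EuclideanSpace ℝ (Fin 3)), ‖u t x‖ ≤ C / Real.sqrt (T - t))
    (hslice : ∀ a : (EuclideanSpace ℝ (Fin 3)), SingularPt T u a → ∃ KA r₂ : ℝ, 0 < r₂ ∧
      ∀ r ∈ Set.Ioo 0 r₂, cknA r (T, a) u ≤ ENNReal.ofReal KA) :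
    ∀ a : (EuclideanSpace ℝ (Fin 3)), SingularPt T u a → ∃ K δ₁ r₁ : ℝ, 0 < δ₁ ∧ 0 < r₁ ∧
      ∀ t ∈ Set.Ioo (T - δ₁) T, ∀ ℓ : ℝ, Real.sqrt (ν * (T - t)) ≤ ℓ → ℓ ≤ r₁ →
        octaveCube u a ℓ t ≤ ENNReal.ofReal (K * ℓ / Real.sqrt (T - t)) := by
  intro a ha
  obtain ⟨C, δ₀, hδ₀, hC⟩ := hrate
  obtain ⟨KA, r₂, hr₂, hA⟩ := hslice a ha
  set Cp : ℝ := max C 0 with hCp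
  have hCp0 : 0 ≤ Cp := le_max_right _ _
  have hν' : 0 < Real.sqrt ν := Real.sqrt_pos.2 hν
  set L : ℝ := Real.exp 1 + 1 / Real.sqrt ν with hL
  have he : 0 < Real.exp 1 := Real.exp_pos 1
  have hLpos : 0 < L := by positivity
  refine ⟨Cp * L * KA, δ₀, r₂ / (2 * L), hδ₀, by positivity, ?_⟩
  intro t ht ℓ hℓ1 hℓ2
  have hTt : 0 < T - t := by linarith [ht.2]
  set s : ℝ := Real.sqrt (T - t) with hs
  have hspos : 0 < s := Real.sqrt_pos.2 hTt
  have hsν : Real.sqrt (ν * (T - t)) = Real.sqrt ν * s := by rw [hs, Real.sqrt_mul hν.le]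
  have hℓpos : 0 < ℓ := lt_of_lt_of_le (by rw [hsν]; positivity) hℓ1
  have hsle : s ≤ ℓ / Real.sqrt ν := by
    rw [le_div_iff₀ hν', mul_comm]; rw [← hsν]; exact hℓ1
  -- the ball radius ρ = eℓ + s
  set ρ : ℝ := Real.exp 1 * ℓ + s with hρ
  have hρpos : 0 < ρ := by positivity
  have hρL : ρ ≤ L * ℓ := by
    have : L * ℓ = Real.exp 1 * ℓ + ℓ / Real.sqrt ν := by rw [hL]; ring
    rw [this]; linarith
  have hρr₂ : ρ < r₂ := by
    have h1 : L * ℓ ≤ L * (r₂ / (2 * L)) := mul_le_mul_of_nonneg_left hℓ2 hLpos.le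
    have h2 : L * (r₂ / (2 * L)) = r₂ / 2 := by field_simp
    linarith
  have htρ : t ∈ Set.Ioo (T - ρ ^ 2) T := by
    refine ⟨?_, ht.2⟩
    have h1 : s < ρ := by rw [hρ]; linarith [mul_pos he hℓpos]
    have h2 : s ^ 2 < ρ ^ 2 := pow_lt_pow_left₀ h1 hspos.le (by norm_num)
    have h3 : s ^ 2 = T - t := by rw [hs, Real.sq_sqrt hTt.le]
    linarith
  -- slice energy on the ball of radius ρ
  have hsl : ∫⁻ y in Metric.ball a ρ, ‖u t y‖ₑ ^ 2 ≤ ENNReal.ofReal ρ * ENNReal.ofReal KA :=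
    slice_energy_le_of_cknA hρpos (hA ρ ⟨hρpos, hρr₂⟩) htρ
  -- pointwise: |u|³ ≤ (Cp/s)|u|²
  have hpt : ∀ y : (EuclideanSpace ℝ (Fin 3)), ‖u t y‖ₑ ^ (3 : ℝ) ≤ ENNReal.ofReal (Cp / s) * ‖u t y‖ₑ ^ 2 := by
    intro y
    have h1 : ‖u t y‖ ≤ Cp / s := by
      refine (hC t ht y).trans ?_
      exact div_le_div_of_nonneg_right (le_max_left _ _) hspos.le
    have h2 : ‖u t y‖ₑ ≤ ENNReal.ofReal (Cp / s) := by
      rw [← ofReal_norm]; exact ENNReal.ofReal_le_ofReal h1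
    have h3 : ‖u t y‖ₑ ^ (3 : ℝ) = ‖u t y‖ₑ ^ (3 : ℕ) := by
      rw [show (3 : ℝ) = ((3 : ℕ) : ℝ) by norm_num, ENNReal.rpow_natCast]
    rw [h3, show ‖u t y‖ₑ ^ (3 : ℕ) = ‖u t y‖ₑ * ‖u t y‖ₑ ^ 2 by ring]
    gcongr
  -- the annulus sits inside the ball of radius ρ
  have hsub : {y : (EuclideanSpace ℝ (Fin 3)) | ℓ < ‖y - a‖ ∧ ‖y - a‖ < Real.exp 1 * ℓ} ⊆ Metric.ball a ρ := by
    intro y hy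
    rw [Metric.mem_ball, dist_eq_norm]
    have : Real.exp 1 * ℓ ≤ ρ := by rw [hρ]; linarith
    exact lt_of_lt_of_le hy.2 this
  -- the chain
  calc octaveCube u a ℓ t
      ≤ ∫⁻ y in {y : (EuclideanSpace ℝ (Fin 3)) | ℓ < ‖y - a‖ ∧ ‖y - a‖ < Real.exp 1 * ℓ},
          ENNReal.ofReal (Cp / s) * ‖u t y‖ₑ ^ 2 := lintegral_mono fun y => hpt y
    _ = ENNReal.ofReal (Cp / s) *
          ∫⁻ y in {y : (EuclideanSpace ℝ (Fin 3)) | ℓ < ‖y - a‖ ∧ ‖y - a‖ < Real.exp 1 * ℓ}, ‖u t y‖ₑ ^ 2 :=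
        lintegral_const_mul' _ _ ENNReal.ofReal_ne_top
    _ ≤ ENNReal.ofReal (Cp / s) * ∫⁻ y in Metric.ball a ρ, ‖u t y‖ₑ ^ 2 :=
        mul_le_mul' le_rfl (lintegral_mono_set hsub)
    _ ≤ ENNReal.ofReal (Cp / s) * (ENNReal.ofReal ρ * ENNReal.ofReal KA) := by
        gcongr
    _ ≤ ENNReal.ofReal (Cp / s) * (ENNReal.ofReal (L * ℓ) * ENNReal.ofReal KA) := by
        gcongr
    _ = ENNReal.ofReal (Cp * L * KA * ℓ / s) := by
        rw [← ENNReal.ofReal_mul (by positivity : (0 : ℝ) ≤ L * ℓ),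
          ← ENNReal.ofReal_mul (by positivity : (0 : ℝ) ≤ Cp / s)]
        congr 1
        ring

/-- **The diagonal theorem from tree-shaped hypotheses**: finite scars, the Literature Type-I predicate
`IsTypeIBlowup u T`, the vertex slice bound `cknA r (T,a) u ≤ K_A` at singular points (the `A`-summand of
`Literature.Analysis.FluidPDE.scaledEnergies_bounded_of_typeIRate`), and the FAILURE of SD give the diagonal
failure sequence. -/
theorem sd_fails_only_on_the_diagonal_of_typeI {ν T : ℝ} (hν : 0 < ν) (hT : 0 < T) {u : ℝ → (EuclideanSpace ℝ (Fin 3)) → (EuclideanSpace ℝ (Fin 3))}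
    {σ : Finset (EuclideanSpace ℝ (Fin 3))}
    (hσ : ∀ x ∉ σ, ∃ r : ℝ, 0 < r ∧ ∃ A : ℝ,
      ∀ t ∈ Set.Ico (T - r ^ 2) T, ∀ y ∈ Metric.ball x r, ‖u t y‖ ≤ A)
    (hI : IsTypeIBlowup u T)
    (hslice : ∀ a : (EuclideanSpace ℝ (Fin 3)), SingularPt T u a → ∃ KA r₂ : ℝ, 0 < r₂ ∧
      ∀ r ∈ Set.Ioo 0 r₂, cknA r (T, a) u ≤ ENNReal.ofReal KA)
    (hSD : ¬ OctaveBudget ν T u) :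
    ∃ a : (EuclideanSpace ℝ (Fin 3)), SingularPt T u a ∧ a ∈ σ ∧ ∃ t ℓ : ℕ → ℝ, (∀ k, t k < T) ∧
      Tendsto t atTop (𝓝 T) ∧ Tendsto ℓ atTop (𝓝[>] 0) ∧
      Tendsto (fun k => ℓ k / Real.sqrt (ν * (T - t k))) atTop atTop ∧
      ∀ q : ℝ, ∀ᶠ k in atTop, ENNReal.ofReal q < octaveCube u a (ℓ k) (t k) :=
  sd_fails_only_on_the_diagonal_tendsto hν hT hσ
    (nearCeiling_of_rate_of_slice hν (rate_of_isTypeIBlowup hI) hslice) hSD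

end Summit.NavierStokesRegularity.NavierStokesRegularity.Cruxes.ScarEnvelopeTypeI.SliceBudget.NullTable

end
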